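import Mathlib.Topology.Algebra.OpenSubgroup
import Literature.AnabelianGeometry.SemiGraphs.TemperedReconstructionEdgeVertexProofs
import Literature.AnabelianGeometry.SemiGraphs.TemperedMaximalCompactProofs
import Literature.AnabelianGeometry.SemiGraphs.TemperedEdgeLikeDistinctOf
import HarnessLib

/-!
# Semi-graphs of anabelioids, §3: Corollary 3.9 (b), uniqueness — the EDGE homomorphisms are
# determined up to conjugation

Mochizuki, *Semi-graphs of anabelioids*, Publ. RIMS **42** (2006), §3, Corollary 3.9 pp. 42–43 with
Remark 2.4.2 p. 26 and Theorem 3.7 (ii)–(iv) pp. 40–41 [cite: MochizukiSemiAnbd2006, Cor 3.9 pp.42-43].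
Proof-only.  Edge analogue of `vertexHom_conj_of_compat` (`TemperedReconstructionUniquenessProofs`):
two edge homomorphisms `θ, θ′ : Π_e → Π_{e′}` with open image, both compatible with `φ` through edge
homomorphisms, differ by an inner automorphism of `Π_{e′}` (`edgeHom_conj_of_compat`).  On the way:
an edge-like subgroup `L` of a closed edge IS the intersection of any two distinct verticial
subgroups containing it (`edgeLike_eq_inf_of_hosts`; print: "the nontrivial intersections of two
distinct maximal compact subgroups are precisely the edge-like subgroups", Thm. 3.7 (iv)), and the
element `k` relating `θ`, `θ′` either normalises the two hosts of `L` — then `k ∈ L` by commensurable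
terminality — or swaps them, which total aloofness forbids (the two branch subgroups of `Π_w` at a
loop are not conjugate; `false_of_conj_branch_images`).  Binders: Thm. 3.7 (i) `VerticialInjective`,
(iii) `CompactInVerticial` ((ii) is `verticialDistinct_holds`; (iv) and `EdgeLikeDistinct` follow,
abc-iut-L3-t11).  Nothing here takes a side on [IUTchIII] Cor. 3.12.
-/

open CategoryTheory Topology

namespace Literature.AnabelianGeometry.SemiGraphs

namespace ProfiniteSemiGraph

universe u

variable {ℋ : ProfiniteSemiGraph.{u}}

/-! ### Conjugated subgroups (bookkeeping) -/

/-- `y ∈ g H g⁻¹ ↔ g⁻¹ y g ∈ H`. [folklore] -/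
private theorem mem_map_conj {Γ : Type u} [Group Γ] (H : Subgroup Γ) (g y : Γ) :
    y ∈ H.map (MulAut.conj g).toMonoidHom ↔ g⁻¹ * y * g ∈ H := by
  rw [Subgroup.mem_map_equiv, MulAut.conj_symm_apply]

/-- `b (a H a⁻¹) b⁻¹ = (b a) H (b a)⁻¹`. [folklore] -/
private theorem map_conj_map_conj {Γ : Type u} [Group Γ] (H : Subgroup Γ) (a b : Γ) :
    (H.map (MulAut.conj a).toMonoidHom).map (MulAut.conj b).toMonoidHom =
      H.map (MulAut.conj (b * a)).toMonoidHom := by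
  ext y
  rw [mem_map_conj, mem_map_conj, mem_map_conj]
  have : a⁻¹ * (b⁻¹ * y * b) * a = (b * a)⁻¹ * y * (b * a) := by group
  rw [this]

/-- `1 H 1⁻¹ = H`. [folklore] -/
private theorem map_conj_one {Γ : Type u} [Group Γ] (H : Subgroup Γ) :
    H.map (MulAut.conj (1 : Γ)).toMonoidHom = H := by
  ext y; rw [mem_map_conj]; simp

/-! ### The aloofness contradiction -/

/-- **The two branch subgroups of `Π_w` at the two branches `b₁ ≠ b₂` of one edge are not conjugate,
even after a verticial homomorphism `φ`** (total aloofness, Def. 2.4 (iv), and the injectivity of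
`φ`, Thm. 3.7 (i)): there is no `m ∈ φ(Π_w)` with `m φ(Π_{b₁}) m⁻¹ = φ(Π_{b₂})`.
[cite: MochizukiSemiAnbd2006, Thm 3.7(iii) p.41] -/
theorem false_of_conj_branch_images (h37i : VerticialInjective.{u}) (hℋ : ℋ.Thm37Hypotheses)
    (c : TemperedPiChart ℋ) {w : ℋ.graph.Vertex} {b₁ b₂ : ℋ.graph.Branch} (hb : b₁ ≠ b₂)
    (hw₁ : ℋ.graph.abuts b₁ = some w) (hw₂ : ℋ.graph.abuts b₂ = some w)
    {φ : ℋ.Gv w →ₜ* c.G} (hφ : IsVerticialHom c w φ) {m : c.G} (hm : m ∈ φ.toMonoidHom.range)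
    (h : ((ℋ.branchSubgroup b₁ w hw₁).map φ.toMonoidHom).map (MulAut.conj m).toMonoidHom =
      (ℋ.branchSubgroup b₂ w hw₂).map φ.toMonoidHom) : False := by
  obtain ⟨γ₀, hγ₀⟩ := hm
  have hinj : Function.Injective φ := (h37i ℋ hℋ c w).2 φ hφ
  have hcomm : φ.toMonoidHom.comp (MulAut.conj γ₀).toMonoidHom =
      (MulAut.conj m).toMonoidHom.comp φ.toMonoidHom := by
    ext x
    show φ (γ₀ * x * γ₀⁻¹) = m * φ x * m⁻¹
    have hγ : (φ γ₀ : c.G) = m := hγ₀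
    rw [map_mul, map_mul, map_inv, hγ]
  rw [Subgroup.map_map, ← hcomm, ← Subgroup.map_map] at h
  have h' : ℋ.branchSubgroup b₂ w hw₂ =
      (ℋ.branchSubgroup b₁ w hw₁).map (MulAut.conj γ₀).toMonoidHom :=
    (Subgroup.map_injective hinj h).symm
  have h0 := hℋ.isTotallyAloof (ℋ.graph.edgeOf b₂) b₂ rfl w hw₂ b₁ hw₁ γ₀ (Or.inl hb)
  rw [← h', Subgroup.relIndex_self] at h0
  exact one_ne_zero h0

/-! ### An edge-like subgroup is the intersection of its two hosts -/

/-- **An edge-like subgroup of a closed edge equals the intersection of any two distinct verticial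
subgroups containing it** ([SemiAnbd] Thm. 3.7 (iv): "the nontrivial intersections of two distinct
maximal compact subgroups … are precisely the edge-like subgroups"): `P₁ ∩ P₂` is edge-like of the
same edge (Thm. 3.7 (iv) + `EdgeLikeDistinct`), hence `γ L γ⁻¹` for some `γ`; `γ` normalises or swaps
`{P₁, P₂}` (Thm. 3.7 (iii)), so `γ² ∈ P₁ ∩ P₂` (commensurable terminality), and conjugation by `γ⁻¹`,
a self-map of `P₁ ∩ P₂` with image `L` whose square is onto, is onto.
[cite: MochizukiSemiAnbd2006, Thm 3.7(iv) p.41] -/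
theorem edgeLike_eq_inf_of_hosts (h37i : VerticialInjective.{u}) (h37iii : CompactInVerticial.{u})
    (hℋ : Cor39Hypotheses ℋ) (c : TemperedPiChart ℋ) {e : ℋ.graph.Edge} {L : Subgroup c.G}
    (hL : L ∈ edgeLikeSubgroups c e) {v₁ v₂ : ℋ.graph.Vertex} {P₁ P₂ : Subgroup c.G}
    (hP₁ : P₁ ∈ verticialSubgroups c v₁) (hP₂ : P₂ ∈ verticialSubgroups c v₂) (hne : P₁ ≠ P₂)
    (hL₁ : L ≤ P₁) (hL₂ : L ≤ P₂) : L = P₁ ⊓ P₂ := by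
  have h37 := hℋ.thm37Hypotheses
  have h37iv : MaximalCompactIffVerticial.{u} :=
    maximalCompactIffVerticial_of_thm37 h37iii verticialDistinct_holds h37i
  have hED : EdgeLikeDistinct.{u} := edgeLikeDistinct_of h37iii verticialDistinct_holds h37i
  obtain ⟨hmax, hint⟩ := h37iv ℋ h37 c
  haveI : Infinite L := infinite_of_mem_edgeLikeSubgroups h37i h37 c hL
  have hL0 : L ≠ ⊥ := by
    intro h0
    have : Finite L := by rw [h0]; infer_instance
    exact not_finite L
  -- `P₁ ⊓ P₂` is edge-like of the same edge
  have hI0 : P₁ ⊓ P₂ ≠ ⊥ := fun h0 => hL0 (le_bot_iff.mp (h0 ▸ le_inf hL₁ hL₂))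
  obtain ⟨e'', -, hI⟩ := (hint (P₁ ⊓ P₂) hI0).mp
    ⟨P₁, P₂, (hmax P₁).mpr ⟨v₁, hP₁⟩, (hmax P₂).mpr ⟨v₂, hP₂⟩, hne, rfl⟩
  have hee : e'' = e := by
    by_contra hee
    have h0 := hED ℋ h37 c e e'' L (P₁ ⊓ P₂) hL hI (Ne.symm hee)
    rw [Subgroup.relIndex_eq_one.mpr (le_inf hL₁ hL₂)] at h0
    exact one_ne_zero h0
  subst hee
  -- `P₁ ⊓ P₂ = γ L γ⁻¹`
  obtain ⟨γ, hγ⟩ := exists_conj_of_mem_edgeLikeSubgroups c hL hI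
  -- `γ` normalises or swaps the hosts; in both cases `γ² ∈ P₁ ⊓ P₂`
  have hC : IsCompact ((P₁ ⊓ P₂ : Subgroup c.G) : Set c.G) := isCompact_of_mem_edgeLikeSubgroups c hI
  obtain ⟨hall, -⟩ :=
    (h37iii ℋ h37 c _ hC).2 hI0 v₁ v₂ P₁ P₂ hP₁ hP₂ hne inf_le_left inf_le_right
  have hγ₁ : P₁ ⊓ P₂ ≤ P₁.map (MulAut.conj γ).toMonoidHom := hγ ▸ Subgroup.map_mono hL₁
  have hγ₂ : P₁ ⊓ P₂ ≤ P₂.map (MulAut.conj γ).toMonoidHom := hγ ▸ Subgroup.map_mono hL₂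
  have h1 := hall v₁ _ (conj_mem_verticialSubgroups c hP₁ γ) hγ₁
  have h2 := hall v₂ _ (conj_mem_verticialSubgroups c hP₂ γ) hγ₂
  have hinjc : Function.Injective (Subgroup.map (MulAut.conj γ).toMonoidHom : Subgroup c.G → _) :=
    Subgroup.map_injective (MulAut.conj γ).injective
  have hγ2 : γ * γ ∈ P₁ ⊓ P₂ := by
    rcases h1 with h1 | h1 <;> rcases h2 with h2 | h2
    · exact absurd (hinjc (h1.trans h2.symm)) hne
    · exact ⟨P₁.mul_mem (mem_of_map_conj_eq h37 c hP₁ h1) (mem_of_map_conj_eq h37 c hP₁ h1),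
        P₂.mul_mem (mem_of_map_conj_eq h37 c hP₂ h2) (mem_of_map_conj_eq h37 c hP₂ h2)⟩
    · -- swap: `γ²` normalises both
      have h1' : P₁.map (MulAut.conj (γ * γ)).toMonoidHom = P₁ := by
        rw [← map_conj_map_conj, h1, h2]
      have h2' : P₂.map (MulAut.conj (γ * γ)).toMonoidHom = P₂ := by
        rw [← map_conj_map_conj, h2, h1]
      exact ⟨mem_of_map_conj_eq h37 c hP₁ h1', mem_of_map_conj_eq h37 c hP₂ h2'⟩
    · exact absurd (hinjc (h1.trans h2.symm)) hne
  -- conjugation by `γ⁻¹` maps `P₁ ⊓ P₂` into `L ⊆ P₁ ⊓ P₂`; its square is onto; hence onto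
  have hmem : ∀ z, z ∈ P₁ ⊓ P₂ ↔ γ⁻¹ * z * γ ∈ L := fun z => by rw [hγ, mem_map_conj]
  refine le_antisymm (le_inf hL₁ hL₂) fun y hy => ?_
  have hy2 : γ * γ * y * (γ * γ)⁻¹ ∈ P₁ ⊓ P₂ :=
    (P₁ ⊓ P₂).mul_mem ((P₁ ⊓ P₂).mul_mem hγ2 hy) ((P₁ ⊓ P₂).inv_mem hγ2)
  have hy1 : γ * y * γ⁻¹ ∈ P₁ ⊓ P₂ := by
    have := (hmem _).mp hy2
    have e1 : γ⁻¹ * (γ * γ * y * (γ * γ)⁻¹) * γ = γ * y * γ⁻¹ := by group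
    rw [e1] at this
    exact le_inf hL₁ hL₂ this
  have := (hmem _).mp hy1
  have e2 : γ⁻¹ * (γ * y * γ⁻¹) * γ = y := by group
  rwa [e2] at this

/-! ### Edge homomorphisms are injective -/

/-- Edge homomorphisms are injective (conjugate to `ψ_w ∘ b_*` with `ψ_w` verticial, Thm. 3.7 (i),
and `b_*` injective). [cite: MochizukiSemiAnbd2006, Thm 3.7(iii) p.41] -/
theorem edgeHom_injective (h37i : VerticialInjective.{u}) (hℋ : Cor39Hypotheses ℋ)
    (c : TemperedPiChart ℋ) {e : ℋ.graph.Edge} {ψ : ℋ.Ge e →ₜ* c.G} (hψ : IsEdgeHom c e ψ) :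
    Function.Injective ψ := by
  obtain ⟨b, -, -, hbe, -, -⟩ := ℋ.graph.two_branches e
  obtain ⟨w, hw⟩ := Option.isSome_iff_exists.mp (hℋ.isGraph.abuts_isSome b)
  subst hbe
  obtain ⟨⟨_, φ, ⟨eφ⟩, rfl⟩, hinj⟩ := h37i ℋ hℋ.thm37Hypotheses c w
  obtain ⟨eψ⟩ := hψ
  obtain ⟨i⟩ := nonempty_res_iso_res_comp_brHom c b w hw ψ φ eψ eφ
  obtain ⟨g, hg, -⟩ := BTemp.exists_conj_of_natTrans c.isTempered ψ (φ.comp (ℋ.brHom b w hw)) i.hom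
  intro x y hxy
  have := congrArg (fun t => g * t * g⁻¹) hxy
  simp only [hg] at this
  exact hℋ.isOfInjectiveType b w hw (hinj φ ⟨eφ⟩ this)

/-! ### Uniqueness up to conjugation at an edge -/

/-- **Cor. 3.9 (b), uniqueness up to conjugation at an edge** ([SemiAnbd] pp. 42–43 with
Rmk. 2.4.2 p. 26): if `θ, θ′ : Π_e → Π_{e′}` have open image and `φ ∘ ψ_e` is conjugate both to
`ψ_{e′} ∘ θ` and to `ψ_{e′} ∘ θ′` for edge homomorphisms `ψ_e` (any hom) and `ψ_{e′}` (at `e′`), then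
`θ = γ_κ ∘ θ′` for some `κ ∈ Π_{e′}`. [cite: MochizukiSemiAnbd2006, Cor 3.9 pp.42-43] -/
theorem edgeHom_conj_of_compat (h37i : VerticialInjective.{u}) (h37iii : CompactInVerticial.{u})
    (hℋ : Cor39Hypotheses ℋ) (c : TemperedPiChart ℋ) {P V : Type u} [Group P] [Group V]
    (φ : P →* c.G) (ψ : V →* P) {e' : ℋ.graph.Edge} {ψ' : ℋ.Ge e' →ₜ* c.G}
    (hψ' : IsEdgeHom c e' ψ') (θ θ' : V →* ℋ.Ge e') (hθ : IsOpen (θ.range : Set (ℋ.Ge e')))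
    {g g' : c.G} (hg : ∀ x, φ (ψ x) = g * ψ' (θ x) * g⁻¹)
    (hg' : ∀ x, φ (ψ x) = g' * ψ' (θ' x) * g'⁻¹) :
    ∃ κ : ℋ.Ge e', ∀ x, θ x = κ * θ' x * κ⁻¹ := by
  haveI := c.t2Space
  have h37 := hℋ.thm37Hypotheses
  have hinjψ : Function.Injective ψ' := edgeHom_injective h37i hℋ c hψ'
  set k : c.G := g⁻¹ * g' with hk
  have hrel : ∀ x, ψ' (θ x) = k * ψ' (θ' x) * k⁻¹ := by
    intro x
    have h1 := (hg x).symm.trans (hg' x)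
    have : ψ' (θ x) = g⁻¹ * (g' * ψ' (θ' x) * g'⁻¹) * g := by rw [← h1]; group
    rw [this, hk]; group
  -- `L₂ = ψ'(Π_{e'})`, `M = ψ'(θ(V))`: `M ≤ L₂ ∩ k L₂ k⁻¹`, finite index in `L₂`, nontrivial, compact
  let L₂ : Subgroup c.G := ψ'.toMonoidHom.range
  have hL₂ : L₂ ∈ edgeLikeSubgroups c e' := ⟨ψ', hψ', rfl⟩
  let M : Subgroup c.G := θ.range.map ψ'.toMonoidHom
  have hML : M ≤ L₂ := by rintro _ ⟨y, -, rfl⟩; exact ⟨y, rfl⟩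
  have hMk : M ≤ L₂.map (MulAut.conj k).toMonoidHom := by
    rintro _ ⟨_, ⟨x, rfl⟩, rfl⟩
    rw [mem_map_conj]
    refine ⟨θ' x, ?_⟩
    change ψ' (θ' x) = k⁻¹ * ψ'.toMonoidHom (θ x) * k
    change ψ' (θ' x) = k⁻¹ * ψ' (θ x) * k
    rw [hrel x]; group
  haveI : Infinite L₂ := infinite_of_mem_edgeLikeSubgroups h37i h37 c hL₂
  have hMi : M.relIndex L₂ ≠ 0 := by
    have hm : MapsOntoOpenSubgroupOf ψ'.toMonoidHom θ.range
        ((⊤ : Subgroup (ℋ.Ge e')).map ψ'.toMonoidHom) :=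
      mapsOntoOpenSubgroupOf_of_eq_map ψ'.toMonoidHom ψ'.continuous hinjψ ψ'.toMonoidHom _ _ hθ rfl
    have htop : L₂ = (⊤ : Subgroup (ℋ.Ge e')).map ψ'.toMonoidHom := MonoidHom.range_eq_map _
    rw [htop]
    refine relIndex_ne_zero_of_mapsOnto ψ'.toMonoidHom ?_ hm
    rw [← htop]
    exact isCompact_of_mem_edgeLikeSubgroups c hL₂
  have hM0 : M ≠ ⊥ := by
    intro h0
    rw [h0, Subgroup.relIndex_bot_left, Nat.card_eq_zero_of_infinite] at hMi
    exact hMi rfl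
  have hMc : IsCompact ((M : Subgroup c.G) : Set c.G) := by
    change IsCompact ((θ.range.map ψ'.toMonoidHom : Subgroup c.G) : Set c.G)
    rw [Subgroup.coe_map]
    exact ((Subgroup.isClosed_of_isOpen _ hθ).isCompact).image ψ'.continuous
  -- the two hosts `P₁ ≠ P₂` of `L₂`, at the vertices of the two branches of `e'`; `L₂ = P₁ ⊓ P₂`
  obtain ⟨b₁, b₂, hb, hb₁, hb₂, -⟩ := ℋ.graph.two_branches e'
  obtain ⟨w₁, hw₁⟩ := Option.isSome_iff_exists.mp (hℋ.isGraph.abuts_isSome b₁)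
  obtain ⟨w₂, hw₂⟩ := Option.isSome_iff_exists.mp (hℋ.isGraph.abuts_isSome b₂)
  obtain ⟨P₁, hP₁, P₂, hP₂, hne, hL₂P₁, hL₂P₂⟩ :=
    exists_verticial_pair_of_mem_edgeLikeSubgroups h37i hℋ c hb hb₁ hb₂ hw₁ hw₂ hL₂
  have hLeq : L₂ = P₁ ⊓ P₂ := edgeLike_eq_inf_of_hosts h37i h37iii hℋ c hL₂ hP₁ hP₂ hne hL₂P₁ hL₂P₂
  -- `k P₁ k⁻¹`, `k P₂ k⁻¹` host `M`; by Thm. 3.7 (iii) they are `P₁`, `P₂` in some order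
  obtain ⟨hall, -⟩ :=
    (h37iii ℋ h37 c M hMc).2 hM0 w₁ w₂ P₁ P₂ hP₁ hP₂ hne (hML.trans hL₂P₁) (hML.trans hL₂P₂)
  have hk₁ := hall w₁ _ (conj_mem_verticialSubgroups c hP₁ k) (hMk.trans (Subgroup.map_mono hL₂P₁))
  have hk₂ := hall w₂ _ (conj_mem_verticialSubgroups c hP₂ k) (hMk.trans (Subgroup.map_mono hL₂P₂))
  have hinjc : Function.Injective (Subgroup.map (MulAut.conj k).toMonoidHom : Subgroup c.G → _) :=
    Subgroup.map_injective (MulAut.conj k).injective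
  -- conclusion when `k ∈ L₂`
  have finish : k ∈ L₂ → ∃ κ : ℋ.Ge e', ∀ x, θ x = κ * θ' x * κ⁻¹ := by
    rintro ⟨κ, hκ⟩
    refine ⟨κ, fun x => hinjψ ?_⟩
    rw [map_mul, map_mul, map_inv, hrel x]
    change k * ψ' (θ' x) * k⁻¹ = ψ'.toMonoidHom κ * ψ' (θ' x) * (ψ'.toMonoidHom κ)⁻¹
    rw [hκ]
  rcases hk₁ with hk₁ | hk₁ <;> rcases hk₂ with hk₂ | hk₂
  · exact absurd (hinjc (hk₁.trans hk₂.symm)) hne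
  · -- `k` normalises both hosts: `k ∈ P₁ ⊓ P₂ = L₂`
    exact finish (hLeq ▸ ⟨mem_of_map_conj_eq h37 c hP₁ hk₁, mem_of_map_conj_eq h37 c hP₂ hk₂⟩)
  rotate_left
  · exact absurd (hinjc (hk₁.trans hk₂.symm)) hne
  · -- `k` SWAPS the hosts: then `w₁ = w₂`, and aloofness forbids it
    exfalso
    have hw : w₁ = w₂ :=
      vertex_eq_of_mem_verticialSubgroups h37 c (conj_mem_verticialSubgroups c hP₁ k) (hk₁ ▸ hP₂)
    subst hw
    -- explicit hosts through the two branches, via ONE verticial homomorphism `χ` at `w₁`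
    obtain ⟨⟨_, χ, hχ, rfl⟩, -⟩ := h37i ℋ h37 c w₁
    obtain ⟨g₁, hg₁⟩ := exists_map_conj_range_eq c hb₁ hw₁ hψ' hχ
    obtain ⟨g₂, hg₂⟩ := exists_map_conj_range_eq c hb₂ hw₂ hψ' hχ
    -- `Hᵢ := gᵢ⁻¹ χ(Π_w) gᵢ ⊇ L₂`
    have hle : ∀ {b : ℋ.graph.Branch} (hw : ℋ.graph.abuts b = some w₁) (g₀ : c.G),
        L₂.map (MulAut.conj g₀).toMonoidHom = (ℋ.branchSubgroup b w₁ hw).map χ.toMonoidHom →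
        L₂ ≤ χ.toMonoidHom.range.map (MulAut.conj g₀⁻¹).toMonoidHom := by
      intro b hw g₀ hg₀ x hx
      have hx' : g₀ * x * g₀⁻¹ ∈ (ℋ.branchSubgroup b w₁ hw).map χ.toMonoidHom := hg₀ ▸ ⟨x, hx, rfl⟩
      obtain ⟨y, -, hy⟩ := hx'
      refine ⟨χ y, ⟨y, rfl⟩, ?_⟩
      change g₀⁻¹ * χ.toMonoidHom y * g₀⁻¹⁻¹ = x
      rw [hy]; group
    have hH₁ := hall w₁ _ (conj_mem_verticialSubgroups c ⟨χ, hχ, rfl⟩ g₁⁻¹)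
      (hML.trans (hle hw₁ g₁ hg₁))
    have hH₂ := hall w₁ _ (conj_mem_verticialSubgroups c ⟨χ, hχ, rfl⟩ g₂⁻¹)
      (hML.trans (hle hw₂ g₂ hg₂))
    -- `Q₀ := χ(Π_w)`; the aloofness contradiction from an `m ∈ Q₀` with `m φ(Π_{b₁}) m⁻¹ = φ(Π_{b₂})`
    have contra : ∀ m : c.G, χ.toMonoidHom.range.map (MulAut.conj m).toMonoidHom = χ.toMonoidHom.range →
        (L₂.map (MulAut.conj g₁).toMonoidHom).map (MulAut.conj m).toMonoidHom =
          L₂.map (MulAut.conj g₂).toMonoidHom → False := by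
      intro m hmQ hmL
      refine false_of_conj_branch_images h37i h37 c hb hw₁ hw₂ hχ (mem_of_map_conj_eq h37 c ⟨χ, hχ, rfl⟩ hmQ) ?_
      rw [← hg₁, ← hg₂]
      exact hmL
    -- the hosts `H₁`, `H₂` are `{P₁, P₂}`; first, they are distinct
    have hH : χ.toMonoidHom.range.map (MulAut.conj g₁⁻¹).toMonoidHom ≠
        χ.toMonoidHom.range.map (MulAut.conj g₂⁻¹).toMonoidHom := by
      intro heq
      refine contra (g₂ * g₁⁻¹) ?_ ?_
      · have := congrArg (Subgroup.map (MulAut.conj g₂).toMonoidHom) heq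
        rw [map_conj_map_conj, map_conj_map_conj, mul_inv_cancel, map_conj_one] at this
        exact this
      · rw [map_conj_map_conj]
        congr 2; group
    -- `k` swaps `H₁`, `H₂` as it swaps `P₁`, `P₂`
    have hkH : (χ.toMonoidHom.range.map (MulAut.conj g₁⁻¹).toMonoidHom).map (MulAut.conj k).toMonoidHom =
        χ.toMonoidHom.range.map (MulAut.conj g₂⁻¹).toMonoidHom := by
      rcases hH₁ with h₁ | h₁ <;> rcases hH₂ with h₂ | h₂
      · exact absurd (h₁.trans h₂.symm) hH
      · rw [h₁, h₂]; exact hk₁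
      · rw [h₁, h₂]; exact hk₂
      · exact absurd (h₁.trans h₂.symm) hH
    -- `k L₂ k⁻¹ = L₂`
    have hkL : L₂.map (MulAut.conj k).toMonoidHom = L₂ := by
      rw [hLeq, Subgroup.map_inf _ _ _ (MulAut.conj k).injective, hk₁, hk₂, inf_comm]
    -- `m := g₂ k g₁⁻¹ ∈ Q₀` conjugates `χ(Π_{b₁})` onto `χ(Π_{b₂})`
    refine contra (g₂ * k * g₁⁻¹) ?_ ?_
    · have := congrArg (Subgroup.map (MulAut.conj g₂).toMonoidHom) hkH
      rw [map_conj_map_conj, map_conj_map_conj, map_conj_map_conj, mul_inv_cancel, map_conj_one] at this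
      exact this
    · rw [map_conj_map_conj]
      have e1 : g₂ * k * g₁⁻¹ * g₁ = g₂ * k := by group
      rw [e1, ← map_conj_map_conj, hkL]

end ProfiniteSemiGraph

end Literature.AnabelianGeometry.SemiGraphs
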